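import Summits.ResolutionOfSingularities.ResolutionOfSingularities.Theses.FrobeniusClosing

/-!
# Route `FrobeniusClosing` — the point-blow-up dynamics NAMED, and the objects of the cut of crux
# `ClosingReduction` (stmt-ResolutionOfSingularities-16347)

The three route items `IsolatedForcedTermination` (target), `BoundedMilnor` (rank 4) and
`NoPeriodicIsolatedAtom` (rank 2) of `Theses/FrobeniusClosing.lean` share one `let`-bound coefficient
calculus (≈ 2.2k characters per statement). This file gives every `let` a name (`clean`, `bl`, `ord`,
`dv`, `tr`, `step`, `run`, `ser`, `pd`, `jac`, `Isol`, `MultP`, `mu`, `PairIso` — VERBATIM the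
route's bodies, so that the three items unfold to them by `Iff.rfl`: `isolatedForcedTermination_iff`,
`boundedMilnor_iff`, `noPeriodicIsolatedAtom_iff`), and declares the objects through which the lines of
crux `ClosingReduction := NoPeriodicIsolatedAtom → BoundedMilnor → IsolatedForcedTermination` are cut
(line `chart-factorization`, `Cruxes/ClosingReduction/Lines/chart_factorization.lean`, reshaped by the
line lead): the Loewy bound `JacPow` (`𝔪^β ≤ jac`), bounded successor pairs `BddSucc`, jet codes
`code`/`decode`, the edge predicate `Edge` of the support item `ClosingLemma` (verbatim its body), the
chart substitution `chartSubst`/`chartMap` of the move "blow up the closed point, chart `i`, pass to the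
point `u_j = τ_j`", and the STATEMENTS of the line's stubs as named propositions (`Factorization`,
`PairIsoKit`, `Transport`, `PairDeterminacy`, `LoewyKit`, `ArenaE`, `Unwinding`). They live under
`Theorems/` (not in the `Cruxes/` work file) so that the stub files `Theorems/FrobeniusClosing…` can
import them — the same arrangement as `Theorems/TeissierJungDefs.lean`.

States are coefficient functions `c : (Fin n → ℕ) → κ` of `a = Σ c(A) u^A ∈ κ[[u₁,…,uₙ]]`, the atom being
the hypersurface `z^p = a`; a move blows up the closed point, passes to chart `u_i` (strict transform
divided by `u_i^p`), translates to the point `u_j = τ_j` of the exceptional divisor and deletes `p`-th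
power monomials (`κ` perfect).

No theorem with content is proved here: definitions, three `Iff.rfl` bridges, reflexivity of `PairIso`.
Sources: the route file (rev 1); Boubakri–Greuel–Markwig, Rev. Mat. Complut. 25 (2012) §1–2
[BoubakriGreuelMarkwig2010] for `Isol`/`mu` and the determinacy statement; Varshavsky, arXiv:1405.6381
Thm 0.1 [Varshavsky2014] for the format of `Edge`.
-/

noncomputable section

-- single-problem summit: the doubled namespace component `ResolutionOfSingularities` is forced
set_option linter.dupNamespace false

open scoped BigOperators Classical

open Summit.ResolutionOfSingularities.ResolutionOfSingularities.Theses.FrobeniusClosing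
  (NoPeriodicIsolatedAtom BoundedMilnor IsolatedForcedTermination)

namespace Summit.ResolutionOfSingularities.ResolutionOfSingularities.Theorems.FrobeniusClosing

/-! ## The point-blow-up dynamics of the route, named (verbatim the route's `let`s) -/

section Dynamics

variable (p n : ℕ) (κ : Type) [Field κ]

/-- `clean c`: delete the `p`-th-power monomials of `a` (reduce `a` modulo `κ[[u]]^p`, `κ` perfect).
[folklore] -/
def clean (c : (Fin n → ℕ) → κ) : (Fin n → ℕ) → κ :=
  fun A => @ite κ (∀ j, p ∣ A j) (Classical.dec _) 0 (c A)

/-- `bl i c`: chart `i` of the blow-up of the closed point (`u_j ↦ u_i u_j` for `j ≠ i`). [folklore] -/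
def bl (i : Fin n) (c : (Fin n → ℕ) → κ) : (Fin n → ℕ) → κ :=
  fun B => @ite κ (Finset.sum (Finset.univ.erase i) (fun j => B j) ≤ B i) (Classical.dec _)
    (c (Function.update B i (B i - Finset.sum (Finset.univ.erase i) (fun j => B j)))) 0

/-- `ord c`: the order (least total degree of a monomial with non-zero coefficient; `0` for `c = 0`).
[folklore] -/
def ord (c : (Fin n → ℕ) → κ) : ℕ :=
  sInf {m : ℕ | ∃ A, c A ≠ 0 ∧ m = Finset.sum Finset.univ (fun j => A j)}

/-- `dv i s c`: divide by `u_i ^ s` (coefficient at `B` is the coefficient at `B + s·e_i`). [folklore] -/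
def dv (i : Fin n) (s : ℕ) (c : (Fin n → ℕ) → κ) : (Fin n → ℕ) → κ :=
  fun B => c (Function.update B i (B i + s))

/-- `tr i τ s c`: pass to the closed point `u_j = τ_j` (`j ≠ i`) of the exceptional divisor (Taylor
shift, truncated at `D_j ≤ B_i + s` — exact on post-blow-up supports; `τ i` is ignored). [folklore] -/
def tr (i : Fin n) (τ : Fin n → κ) (s : ℕ) (c : (Fin n → ℕ) → κ) : (Fin n → ℕ) → κ :=
  fun B => Finset.sum (Fintype.piFinset (fun _ : Fin n => Finset.range (B i + s + 1)))
    (fun D => @ite κ (D i = 0) (Classical.dec _) (c (B + D) * Finset.prod (Finset.univ.erase i)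
      (fun j => ((Nat.choose (B j + D j) (B j) : ℕ) : κ) * τ j ^ (D j))) 0)

/-- `step i τ c`: ONE MOVE of the dynamics — clean, blow up the closed point, chart `i`, divide the
strict transform by `u_i ^ p` (when the cleaned order is `≥ p`), translate to the point `τ`, clean.
[folklore] -/
def step (i : Fin n) (τ : Fin n → κ) (c : (Fin n → ℕ) → κ) : (Fin n → ℕ) → κ :=
  clean p n κ (tr n κ i τ (@ite ℕ (p ≤ ord n κ (clean p n κ c)) (Classical.dec _) p 0)
    (dv n κ i (@ite ℕ (p ≤ ord n κ (clean p n κ c)) (Classical.dec _) p 0) (bl n κ i (clean p n κ c))))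

/-- `run c₀ i t m`: the `m`-th state of the run from `c₀` along the chart word `i` and the
translation word `t`. [folklore] -/
def run (c₀ : (Fin n → ℕ) → κ) (i : ℕ → Fin n) (t : ℕ → Fin n → κ) (m : ℕ) : (Fin n → ℕ) → κ :=
  @Nat.rec (fun _ => (Fin n → ℕ) → κ) c₀ (fun m c => step p n κ (i m) (t m) c) m

/-- `ser c ∈ κ[[u₁,…,uₙ]]`: the cleaned series of the state `c`. [folklore] -/
def ser (c : (Fin n → ℕ) → κ) : MvPowerSeries (Fin n) κ :=
  show MvPowerSeries (Fin n) κ from fun A : Fin n →₀ ℕ => clean p n κ c ⇑A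

/-- `pd i f = ∂f/∂u_i` (formal partial derivative, coefficient formula; equals the tree's
`MvPowerSeries.pderiv i f` up to `Nat.cast_succ`). [folklore] -/
def pd (i : Fin n) (f : MvPowerSeries (Fin n) κ) : MvPowerSeries (Fin n) κ :=
  show MvPowerSeries (Fin n) κ from fun A : Fin n →₀ ℕ => ((A i + 1 : ℕ) : κ) * f (A + Finsupp.single i 1)

/-- `jac c = (∂₁ a, …, ∂ₙ a)`: the Jacobian ideal of the cleaned series. [folklore] -/
def jac (c : (Fin n → ℕ) → κ) : Ideal (MvPowerSeries (Fin n) κ) :=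
  Ideal.span (Set.range (fun i => pd n κ i (ser p n κ c)))

/-- `Isol c`: the point is ISOLATED — the Milnor algebra `κ[[u]]/jac` is finite over `κ`.
[cite: BoubakriGreuelMarkwig2010, §1 (p. 3)] -/
def Isol (c : (Fin n → ℕ) → κ) : Prop :=
  Module.Finite κ (MvPowerSeries (Fin n) κ ⧸ jac p n κ c)

/-- `MultP c`: MULTIPLICITY `p` — the cleaned series is non-zero of order `≥ p`. [folklore] -/
def MultP (c : (Fin n → ℕ) → κ) : Prop :=
  (∃ A, clean p n κ c A ≠ 0) ∧ ∀ A, clean p n κ c A ≠ 0 → p ≤ Finset.sum Finset.univ (fun j => A j)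

/-- `mu c = dim_κ κ[[u]]/jac`: the Milnor-type colength (`Module.finrank`, so `0` if infinite; read
with `Isol`). [cite: BoubakriGreuelMarkwig2010, §1 (p. 3)] -/
def mu (c : (Fin n → ℕ) → κ) : ℕ :=
  Module.finrank κ (MvPowerSeries (Fin n) κ ⧸ jac p n κ c)

/-- `PairIso c c'`: the pairs `(κ[[u]], [a])`, `(κ[[u]], [a'])` are isomorphic — a `κ`-automorphism
`φ` of `κ[[u]]`, a unit `v` and a series `g` with `φ(a) = v^p a' + g^p` (the hypersurfaces `z^p = a`,
`z^p = a'` are then isomorphic by `z ↦ (z - g)/v`). [folklore] -/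
def PairIso (c c' : (Fin n → ℕ) → κ) : Prop :=
  ∃ (φ : MvPowerSeries (Fin n) κ ≃ₐ[κ] MvPowerSeries (Fin n) κ) (v g : MvPowerSeries (Fin n) κ),
    IsUnit v ∧ φ (ser p n κ c) = v ^ p * ser p n κ c' + g ^ p

/-- `JacPow β c`: the LOEWY BOUND `𝔪^β ≤ jac` — every monomial of degree `β` lies in the Jacobian
ideal. Given `Isol c` it is equivalent to `mu c ≤ dim κ[[u]]/𝔪^β`-type bounds (`mu c ≤ β → JacPow β c`,
`JacPow β c → Isol c`, Nakayama); it is the finiteness condition the arena records, because it is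
polynomial on the `(β+1)`-jet. [folklore] -/
def JacPow (β : ℕ) (c : (Fin n → ℕ) → κ) : Prop :=
  IsLocalRing.maximalIdeal (MvPowerSeries (Fin n) κ) ^ β ≤ jac p n κ c

end Dynamics

/-! ## Bridges: the three route items ARE statements about the named dynamics (definitional) -/

/-- `IsolatedForcedTermination` unfolded to the named dynamics. [folklore] -/
theorem isolatedForcedTermination_iff :
    IsolatedForcedTermination ↔
      ∀ p : ℕ, p.Prime → ∀ n : ℕ, 0 < n → ∀ (κ : Type) [Field κ] [CharP κ p] [PerfectField κ]
        (c₀ : (Fin n → ℕ) → κ) (i : ℕ → Fin n) (t : ℕ → Fin n → κ),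
        ¬ (∀ m, Isol p n κ (run p n κ c₀ i t m) ∧ MultP p n κ (run p n κ c₀ i t m)) :=
  Iff.rfl

/-- `BoundedMilnor` unfolded to the named dynamics. [folklore] -/
theorem boundedMilnor_iff :
    BoundedMilnor ↔
      ∀ p : ℕ, p.Prime → ∀ n : ℕ, 0 < n → ∀ (κ : Type) [Field κ] [CharP κ p] [PerfectField κ]
        (c₀ : (Fin n → ℕ) → κ) (i : ℕ → Fin n) (t : ℕ → Fin n → κ),
        (∀ m, Isol p n κ (run p n κ c₀ i t m) ∧ MultP p n κ (run p n κ c₀ i t m)) →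
          ∃ β : ℕ, ∀ m, mu p n κ (run p n κ c₀ i t m) ≤ β :=
  Iff.rfl

/-- `NoPeriodicIsolatedAtom` unfolded to the named dynamics. [folklore] -/
theorem noPeriodicIsolatedAtom_iff :
    NoPeriodicIsolatedAtom ↔
      ∀ p : ℕ, p.Prime → ∀ n : ℕ, 0 < n → ∀ (κ : Type) [Field κ] [Algebra (ZMod p) κ]
        [Algebra.IsAlgebraic (ZMod p) κ] (c₀ : (Fin n → ℕ) → κ) (i : ℕ → Fin n) (t : ℕ → Fin n → κ)
        (r : ℕ), 0 < r →
        (∀ m, m ≤ r → Isol p n κ (run p n κ c₀ i t m) ∧ MultP p n κ (run p n κ c₀ i t m)) →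
          ¬ PairIso p n κ (run p n κ c₀ i t 0) (run p n κ c₀ i t r) :=
  Iff.rfl

/-- `PairIso` is reflexive (`φ = id`, `v = 1`, `g = 0`; `p ≠ 0`). [folklore] -/
theorem pairIso_refl {p : ℕ} (hp : p ≠ 0) (n : ℕ) (κ : Type) [Field κ] (c : (Fin n → ℕ) → κ) :
    PairIso p n κ c c :=
  ⟨AlgEquiv.refl, 1, 0, isUnit_one, by simp [zero_pow hp]⟩

/-! ## Objects of the cut of crux `ClosingReduction` (line `chart-factorization`) -/

section Cut

/-- `BddSucc p n β K c c'` — BOUNDED SUCCESSOR UP TO PAIR-ISOMORPHISM: `c` is a multiplicity-`p` state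
with the Loewy bound `𝔪^β ≤ jac c`; for some chart `i` and translation `τ ∈ Kⁿ` the honest successor
`step i τ c` again has multiplicity `p` and the Loewy bound; and `c'` (same two conditions) is
pair-isomorphic to that successor. [folklore] -/
def BddSucc (p n β : ℕ) (K : Type) [Field K] (c c' : (Fin n → ℕ) → K) : Prop :=
  ∃ (i : Fin n) (τ : Fin n → K),
    (JacPow p n K β c ∧ MultP p n K c) ∧
    (JacPow p n K β (step p n K i τ c) ∧ MultP p n K (step p n K i τ c)) ∧
    (JacPow p n K β c' ∧ MultP p n K c') ∧
    PairIso p n K (step p n K i τ c) c'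

/-- `code e c ∈ Kᴺ`: the cleaned coefficients of the state `c` at the recorded monomials
`e : Fin N → (Fin n → ℕ)`. [folklore] -/
def code (p n : ℕ) (K : Type) [Field K] {N : ℕ} (e : Fin N → (Fin n → ℕ)) (c : (Fin n → ℕ) → K) :
    Fin N → K :=
  fun s => clean p n K c (e s)

/-- `decode e x`: the polynomial state with coefficient `x s` at the monomial `e s` and `0` at the
monomials not recorded. [folklore] -/
def decode (n : ℕ) (K : Type) [Field K] {N : ℕ} (e : Fin N → (Fin n → ℕ)) (x : Fin N → K) :
    (Fin n → ℕ) → K :=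
  fun A => @dite K (∃ s, e s = A) (Classical.dec _) (fun h => x (Classical.choose h)) (fun _ => 0)

/-- `Edge p P Q K x y`: `(x, y) ∈ T(K)` for `T = ⋃ⱼ V(P j) ∖ V(Q j) ⊆ 𝔸ᴺ × 𝔸ᴺ` over `ℤ/p` —
VERBATIM the edge predicate of the route's support item `ClosingLemma` (so that `T`-paths here are
`ClosingLemma`'s paths definitionally). [cite: Varshavsky2014, Thm. 0.1 (format of `T`)] -/
def Edge (p : ℕ) {N k : ℕ} (P Q : Fin k → Finset (MvPolynomial (Fin N ⊕ Fin N) (ZMod p)))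
    (K : Type) [Field K] [Algebra (ZMod p) K] (x y : Fin N → K) : Prop :=
  ∃ j, (∀ f ∈ P j, MvPolynomial.aeval (Sum.elim x y) f = 0) ∧
    ∃ g ∈ Q j, MvPolynomial.aeval (Sum.elim x y) g ≠ 0

variable (n : ℕ) (K : Type) [Field K]

/-- The CHART SUBSTITUTION data of the move "blow up the closed point, chart `i`, pass to the point
`u_j = τ_j` of the exceptional divisor": `u_i ↦ u_i`, `u_j ↦ u_i · (u_j + τ_j)` (`j ≠ i`; `τ i` is
ignored, as in `tr`). [folklore] -/
def chartSubst (i : Fin n) (τ : Fin n → K) : Fin n → MvPowerSeries (Fin n) K :=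
  fun j => if j = i then MvPowerSeries.X i
    else MvPowerSeries.X i * (MvPowerSeries.X j + MvPowerSeries.C (τ j))

/-- `chartMap i τ f = σ_{i,τ}(f) = f(u_i(u₁+τ₁), …, u_i, …, u_i(uₙ+τₙ))`: the substitution endomorphism of
`K[[u]]` of the chart move (`MvPowerSeries.subst`; the substituted series have zero constant
coefficient). On a cleaned state of order `≥ p`, the route's `tr i τ p ∘ dv i p ∘ bl i` is, on series,
`f ↦ σ_{i,τ}(f) / u_i^p`. [folklore] -/
def chartMap (i : Fin n) (τ : Fin n → K) (f : MvPowerSeries (Fin n) K) : MvPowerSeries (Fin n) K :=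
  MvPowerSeries.subst (chartSubst n K i τ) f

end Cut

/-! ## Statements of the stubs of line `chart-factorization` (named propositions; proved — or not —
in their own `Theorems/FrobeniusClosingClosingReduction…` files, never asserted here) -/

/-- **`Factorization`** — CHART FACTORIZATION: for every field `K`, `n ≥ 1`, every `K`-algebra
automorphism `φ` of `K[[u₁,…,uₙ]]` and every chart point `(i, τ)` there are a chart point `(i', τ')` and
a `K`-algebra automorphism `φ'` with `σ_{i',τ'} ∘ φ = φ' ∘ σ_{i,τ}` (universal property of blowing up
the closed point, in coordinates: `(i',τ')` = chart of `L⁻¹ e(i,τ)` for the linear part `L` of `φ`,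
`φ'(u_i) = σ_{i',τ'}(φ u_i) = u_{i'}·unit`, `φ'(u_j) = U_j/U_i − τ_j`). A route-posited sub-statement (stub
statement of line `chart-factorization` of crux `ClosingReduction`; not a published result — it is the
universal property of the point blow-up written in formal coordinates). Informal sources of the
programme: Hartshorne II.7.15; the strategist's census `Cruxes/ClosingReduction/STRATEGY-CENSUS.md`. -/
def Factorization : Prop :=
  ∀ n : ℕ, 0 < n → ∀ (K : Type) [Field K]
    (φ : MvPowerSeries (Fin n) K ≃ₐ[K] MvPowerSeries (Fin n) K) (i : Fin n) (τ : Fin n → K),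
    ∃ (i' : Fin n) (τ' : Fin n → K) (φ' : MvPowerSeries (Fin n) K ≃ₐ[K] MvPowerSeries (Fin n) K),
      ∀ f : MvPowerSeries (Fin n) K, chartMap n K i' τ' (φ f) = φ' (chartMap n K i τ f)

/-- **`PairIsoKit`** — over a field `K` of characteristic `p` (`p` prime, `n ≥ 1`): `PairIso` is
symmetric and transitive (reflexive by `pairIso_refl`), and `Isol`, `MultP` and every Loewy bound
`JacPow β` are `PairIso`-invariant (`∂_j(v^p a' + g^p) = v^p ∂_j a'` in characteristic `p`; chain rule
`jac(φ a) = φ(jac a)` for automorphisms; a `p`-th power has only `p`-divisible exponents, a cleaned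
series none). No perfectness is needed. A route-posited sub-statement (stub statement of line
`chart-factorization`; not a published result). -/
def PairIsoKit : Prop :=
  ∀ p : ℕ, p.Prime → ∀ n : ℕ, 0 < n → ∀ (K : Type) [Field K] [CharP K p],
    (∀ c c' : (Fin n → ℕ) → K, PairIso p n K c c' → PairIso p n K c' c) ∧
    (∀ c c' c'' : (Fin n → ℕ) → K, PairIso p n K c c' → PairIso p n K c' c'' → PairIso p n K c c'') ∧
    (∀ c c' : (Fin n → ℕ) → K, PairIso p n K c c' →
      (Isol p n K c ↔ Isol p n K c') ∧ (MultP p n K c ↔ MultP p n K c') ∧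
      ∀ β : ℕ, (JacPow p n K β c ↔ JacPow p n K β c'))

/-- **`Transport`** — TRANSPORT OF SUCCESSOR POINTS along a pair isomorphism, over a perfect field `K`
of characteristic `p`: if `PairIso c c'` and `c` has multiplicity `p`, every successor `step i τ c` is
pair-isomorphic to some successor `step i' τ' c'` of `c'` (dictionary `ser (step i τ c) =
clean(σ_{i,τ}(ser c)/u_i^p)`, `Factorization`, and `p`-th-power bookkeeping: `g ∈ 𝔪`, `σ'(g) ∈ (u_{i'})`,
the cleaned-away part is a `p`-th power over a perfect field). A route-posited sub-statement (stub
statement of line `chart-factorization`; not a published result). -/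
def Transport : Prop :=
  ∀ p : ℕ, p.Prime → ∀ n : ℕ, 0 < n → ∀ (K : Type) [Field K] [CharP K p] [PerfectField K]
    (c c' : (Fin n → ℕ) → K), PairIso p n K c c' → MultP p n K c →
    ∀ (i : Fin n) (τ : Fin n → K), ∃ (i' : Fin n) (τ' : Fin n → K),
      PairIso p n K (step p n K i τ c) (step p n K i' τ' c')

/-- **`PairDeterminacy`** — finite determinacy for the pair group, `n ≥ 2`, over an ALGEBRAICALLY
CLOSED field: a multiplicity-`p` state `c` with the Loewy bound `𝔪^β ≤ jac c` is pair-isomorphic to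
every `c'` whose cleaned coefficients agree with those of `c` in all total degrees `≤ 2β`
(Boubakri–Greuel–Markwig Thm 2.1(1) with `k = β`: `𝔪^{β+2} ⊆ 𝔪²·j(f)` ⇒ right `(2β − ord + 2)`-determined,
and `ord ≥ p ≥ 2`; right equivalence ⊆ the pair group). The case `n = 1` is not needed (the crux's
conclusion holds outright there, `Theorems.ClosingReduction.Negative.isolatedForcedTermination_dim_one`).
A route-posited sub-statement (stub statement of line `chart-factorization`; the stub derives it from
the vendored named fact `Literature.AlgebraicGeometry.Resolution.BoubakriGreuelMarkwig.Thm21`; it is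
not itself a published result). Informal source of the programme: Boubakri–Greuel–Markwig, Rev. Mat.
Complut. 25 (2012), Thm 2.1. -/
def PairDeterminacy : Prop :=
  ∀ p : ℕ, p.Prime → ∀ (n β : ℕ) (K : Type) [Field K] [IsAlgClosed K]
    (c c' : (Fin n → ℕ) → K), 2 ≤ n → JacPow p n K β c → MultP p n K c →
    (∀ A : Fin n → ℕ, Finset.sum Finset.univ (fun j => A j) ≤ 2 * β →
      clean p n K c A = clean p n K c' A) →
    PairIso p n K c c'

/-- **`LoewyKit`** — the Loewy bound versus the Milnor algebra, over EVERY field: (1) `Isol c` and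
`mu c ≤ β` give `𝔪^β ≤ jac c` (strict `𝔪`-adic chain in the finite-dimensional Milnor algebra, Nakayama);
(2) `𝔪^β ≤ jac c` gives `Isol c` (`κ[[u]]/𝔪^β` is finite-dimensional); (3) "`𝔪^β ≤ jac c`" IS
DIOPHANTINE ON THE JET, uniformly in the field: for `p` prime, `n ≥ 1`, `β` and EVERY list `e` of recorded
monomials covering the non-`p`-th-power monomials of total degree `≤ β + 1`, there is ONE finite system
`G ⊆ (ℤ/p)[X ⊕ W]` with `JacPow β c ↔ ∃ w, G(code e c, w) = 0` over every field `K ⊇ ℤ/p`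
(`𝔪^β ≤ jac + 𝔪^{β+1}` is bilinear in the `(β+1)`-jet and the coefficients of the multipliers, and is
equivalent to `𝔪^β ≤ jac` by Nakayama; cleaned coefficients at `p`-th-power monomials vanish, so
those monomials need not be recorded). A route-posited sub-statement (stub statement of line
`chart-factorization`; not a published result). -/
def LoewyKit : Prop :=
  (∀ (p n : ℕ) (K : Type) [Field K] (c : (Fin n → ℕ) → K) (β : ℕ),
      Isol p n K c → mu p n K c ≤ β → JacPow p n K β c) ∧
  (∀ (p n : ℕ) (K : Type) [Field K] (c : (Fin n → ℕ) → K) (β : ℕ),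
      JacPow p n K β c → Isol p n K c) ∧
  (∀ p : ℕ, p.Prime → ∀ n : ℕ, 0 < n → ∀ (β N : ℕ) (e : Fin N → (Fin n → ℕ)),
    (∀ A : Fin n → ℕ, Finset.sum Finset.univ (fun j => A j) ≤ β + 1 → (¬ ∀ j, p ∣ A j) →
      ∃ s, e s = A) →
    ∃ (M : ℕ) (G : Finset (MvPolynomial (Fin N ⊕ Fin M) (ZMod p))),
      ∀ (K : Type) [Field K] [Algebra (ZMod p) K] (c : (Fin n → ℕ) → K),
        JacPow p n K β c ↔
          ∃ w : Fin M → K, ∀ g ∈ G, MvPolynomial.aeval (Sum.elim (code p n K e c) w) g = 0)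

/-- **`ArenaE`** — THE DIOPHANTINE ARENA in the support item's native format (`n ≥ 2`): for `p` prime,
`n`, `β` there are sizes `N` (jet code) and `M` (witness block), recorded monomials `e` and ONE system
`(P, Q)` over `ℤ/p` on `𝔸^{N+M} × 𝔸^{N+M}` such that (ENCODE) over every field `K ⊇ ℤ/p`, for an
honest step `c ↦ step i τ c` between multiplicity-`p` states with the Loewy bound there is a witness
block `w` making `((code c, w), (code (step i τ c), w'))` an edge for EVERY `w'`, and (DECODE) over
every algebraically closed `K ⊇ ℤ/p`, every edge `(v, v')` yields a bounded successor pair between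
the decoded jet blocks. A route-posited sub-statement (stub statement of line `chart-factorization`;
not a published result). -/
def ArenaE : Prop :=
  ∀ p : ℕ, p.Prime → ∀ n : ℕ, 2 ≤ n → ∀ β : ℕ,
    ∃ (N M k : ℕ) (e : Fin N → (Fin n → ℕ))
      (P Q : Fin k → Finset (MvPolynomial (Fin (N + M) ⊕ Fin (N + M)) (ZMod p))),
      (∀ (K : Type) [Field K] [Algebra (ZMod p) K] (c : (Fin n → ℕ) → K)
          (i : Fin n) (τ : Fin n → K),
          JacPow p n K β c → MultP p n K c →
          JacPow p n K β (step p n K i τ c) → MultP p n K (step p n K i τ c) →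
          ∃ w : Fin M → K, ∀ w' : Fin M → K,
            Edge p P Q K (Fin.append (code p n K e c) w)
              (Fin.append (code p n K e (step p n K i τ c)) w')) ∧
      (∀ (K : Type) [Field K] [Algebra (ZMod p) K] [IsAlgClosed K] (v v' : Fin (N + M) → K),
          Edge p P Q K v v' →
            BddSucc p n β K (decode n K e (v ∘ Fin.castAdd M)) (decode n K e (v' ∘ Fin.castAdd M)))

/-- **`Unwinding`** — over a field `K` ALGEBRAIC over `𝔽_p`, a finite chain `c 0 → c 1 → ⋯ → c r = c 0`
(`r > 0`) of bounded successor pairs is realised by an honest run: a start `d₀`, a chart word and a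
translation word over `K` and `r' > 0` with all states `0..r'` isolated of multiplicity `p` and
`PairIso (run 0) (run r')` — exactly the configuration `NoPeriodicIsolatedAtom` forbids (one transport
per step; `𝔪^β ≤ jac` gives `Isol`). A route-posited sub-statement (stub statement of line
`chart-factorization`; not a published result). -/
def Unwinding : Prop :=
  ∀ p : ℕ, p.Prime → ∀ n : ℕ, 0 < n → ∀ (β : ℕ) (K : Type) [Field K] [Algebra (ZMod p) K]
    [Algebra.IsAlgebraic (ZMod p) K] (c : ℕ → (Fin n → ℕ) → K) (r : ℕ), 0 < r → c r = c 0 →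
    (∀ m, m < r → BddSucc p n β K (c m) (c (m + 1))) →
    ∃ (d₀ : (Fin n → ℕ) → K) (i : ℕ → Fin n) (t : ℕ → Fin n → K) (r' : ℕ), 0 < r' ∧
      (∀ m, m ≤ r' → Isol p n K (run p n K d₀ i t m) ∧ MultP p n K (run p n K d₀ i t m)) ∧
      PairIso p n K (run p n K d₀ i t 0) (run p n K d₀ i t r')

end Summit.ResolutionOfSingularities.ResolutionOfSingularities.Theorems.FrobeniusClosing

end
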